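import Literature.Topology.PlaneTopology.WindingNumber
import Literature.Probability.RandomPlanarGeometry.LoopConfigurations
import HarnessLib

/-!
# Winding numbers of based and unbased loops; orientation from closeness

Tool of the orientation lemma of the `dkkmo_rotation_invariance` bridge (side condition
`OrientedMatching` of `LoopMatching`), built on the plane-topology prelude's winding number
`Literature.wind : (ℝ → ℂ) → ℤ` (`Literature.Topology.PlaneTopology.WindingNumber`: `wind_spec`,
`wind_eq_of_norm_sub_lt`, `wind_mul`, `wind_const`). The winding number `W(u, z) ∈ ℤ` of a
planar loop around a point off its trace descends from parametrised curves (`Curve.wind γ z :=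
wind (t ↦ γ t − z)`) to curve classes, based loops and *unbased oriented loops*
(`UnbasedLoop.wind`), because it is invariant under increasing reparametrisation
(`Curve.wind_reparam`), under change of base point (`Curve.wind_shift`, via the free-homotopy
invariance `wind_eq_of_homotopy` applied to the shifts `s ↦ γ.shift (s a)`), and stable under
perturbations smaller than the distance from the point to the trace (`Curve.wind_eq_of_loopDist_lt`).
Time reversal negates it (`Curve.wind_reverse`, `UnbasedLoop.wind_reverse`), orientation-preserving
similarities preserve it (`Curve.wind_map_affine`). Consequently
(`UnbasedLoop.wind_eq_or_eq_neg_of_udist_lt`) two unbased loops that are closer in DKKMO's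
*unoriented* distance `d = udist` (arXiv:2012.11672v2, eq. (1)) than the distance from `z` to the
trace have winding numbers equal *up to sign*, and — the **orientation lemma**
`UnbasedLoop.dist_le_of_udist_le` — if one of them winds around some such point (`W ≠ 0`: a *fat*
loop at scale `ε`) and both have winding numbers of a fixed sign everywhere (as exterior
boundaries of clusters do), then `d ≤ ε` forces the *oriented* unbased distance to be `≤ ε`.

Also: `wind_eq_of_homotopy` — free-homotopy invariance of `Literature.Topology.PlaneTopology.wind` for a family of
nonvanishing loops `H s`, `s ∈ [0, 1]`, jointly continuous on `[0,1]²` (locally constant by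
`wind_eq_of_norm_sub_lt` and uniform continuity, hence constant on the connected interval).

## References

* W. Fulton, *Algebraic Topology: A First Course* (1995), §3 (winding numbers, dog-on-a-leash).
* H. Duminil-Copin et al., arXiv:2012.11672v2 (2026), §1.2 eq. (1); §3.5 ("the loops of `ω` are
  oriented so as to have primal edges on their right").
-/

noncomputable section

open Set Metric Complex Filter Topology
open scoped unitInterval Real

namespace Literature.Probability.RandomPlanarGeometry

/-! ### Free-homotopy invariance of `wind` -/

/-- **Free-homotopy invariance of the winding number.** If `H : [0,1] × [0,1] → ℂ ∖ {0}` is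
jointly continuous and every `H s` is a loop (`H s 0 = H s 1`), then `wind (H 0) = wind (H 1)`:
by uniform continuity and `wind_eq_of_norm_sub_lt`, `s ↦ wind (H s)` is locally constant on the
connected interval. [folklore] -/
theorem wind_eq_of_homotopy (H : ℝ → ℝ → ℂ)
    (hH : ContinuousOn (fun p : ℝ × ℝ ↦ H p.1 p.2) (Icc 0 1 ×ˢ Icc 0 1))
    (hne : ∀ s ∈ Icc (0 : ℝ) 1, ∀ t ∈ Icc (0 : ℝ) 1, H s t ≠ 0)
    (hloop : ∀ s ∈ Icc (0 : ℝ) 1, H s 0 = H s 1) : Literature.Topology.PlaneTopology.wind (H 0) = Literature.Topology.PlaneTopology.wind (H 1) := by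
  -- read the family on the closed square via `projIcc`
  set P : ℝ → ℝ := fun s ↦ (projIcc 0 1 zero_le_one s : ℝ) with hP
  have hPmem : ∀ s, P s ∈ Icc (0 : ℝ) 1 := fun s ↦ (projIcc 0 1 zero_le_one s).2
  have hPc : Continuous P := continuous_subtype_val.comp continuous_projIcc
  have hloopP : ∀ s, Literature.Topology.PlaneTopology.IsNonvanishingLoop (H (P s)) := fun s ↦
    ⟨hH.comp (f := fun t : ℝ ↦ (P s, t)) (Continuous.continuousOn (by fun_prop))
        fun t ht ↦ ⟨hPmem s, ht⟩,
      fun t ht ↦ hne _ (hPmem s) t ht, hloop _ (hPmem s)⟩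
  -- local constancy of `s ↦ wind (H (P s))`
  set g : ℝ → ℤ := fun s ↦ Literature.Topology.PlaneTopology.wind (H (P s)) with hg
  have hlc : IsLocallyConstant g := by
    rw [IsLocallyConstant.iff_eventually_eq]
    intro s₀
    -- positive minimum of `‖H (P s₀) ·‖` on `[0, 1]`
    obtain ⟨t₀, ht₀, hmin⟩ := isCompact_Icc.exists_isMinOn (nonempty_Icc.2 zero_le_one)
      ((continuous_norm.comp_continuousOn (hloopP s₀).continuousOn))
    set m : ℝ := ‖H (P s₀) t₀‖ with hm
    have hm0 : 0 < m := norm_pos_iff.2 ((hloopP s₀).ne_zero t₀ ht₀)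
    -- uniform continuity of `H` on the square
    have huc := (isCompact_Icc.prod isCompact_Icc).uniformContinuousOn_of_continuous hH
    rw [Metric.uniformContinuousOn_iff] at huc
    obtain ⟨η, hη, hηH⟩ := huc m hm0
    have hev : ∀ᶠ s in 𝓝 s₀, dist (P s) (P s₀) < η :=
      hPc.continuousAt.eventually (Metric.ball_mem_nhds _ hη)
    filter_upwards [hev] with s hs
    refine Literature.Topology.PlaneTopology.wind_eq_of_norm_sub_lt (hloopP s).continuousOn (hloopP s).eq_endpoints (hloopP s₀) ?_
    intro t ht
    have h1 : dist (H (P s) t) (H (P s₀) t) < m := by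
      have := hηH (P s, t) ⟨hPmem s, ht⟩ (P s₀, t) ⟨hPmem s₀, ht⟩ (by
        rw [Prod.dist_eq, dist_self, max_lt_iff]; exact ⟨hs, hη⟩)
      simpa using this
    calc ‖H (P s) t - H (P s₀) t‖ = dist (H (P s) t) (H (P s₀) t) := (dist_eq_norm _ _).symm
      _ < m := h1
      _ ≤ ‖H (P s₀) t‖ := hmin ht
  have key := hlc.apply_eq_of_isPreconnected isPreconnected_univ (mem_univ (0 : ℝ)) (mem_univ 1)
  simp only [hg, hP, projIcc_left, projIcc_right] at key
  exact key

namespace Curve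

variable {γ γ₁ γ₂ : Curve ℂ} {z : ℂ}

/-- The curve read on `ℝ` (clamped to `[0, 1]`) minus the point `z`: the loop whose `Literature.Topology.PlaneTopology.wind`
is the winding number of `γ` around `z`. [folklore] -/
def subPt (γ : Curve ℂ) (z : ℂ) : ℝ → ℂ := fun t ↦ IccExtend zero_le_one γ t - z

/-- `subPt` on `[0, 1]`. [folklore] -/
theorem subPt_of_mem (γ : Curve ℂ) (z : ℂ) {t : ℝ} (ht : t ∈ Icc (0 : ℝ) 1) :
    γ.subPt z t = γ ⟨t, ht⟩ - z := by
  rw [subPt, IccExtend_of_mem _ _ ht]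

/-- `subPt` is continuous. [folklore] -/
theorem continuous_subPt (γ : Curve ℂ) (z : ℂ) : Continuous (γ.subPt z) :=
  (γ.continuous.Icc_extend').sub continuous_const

/-- Loops have equal `subPt` endpoints. [folklore] -/
theorem subPt_zero_eq_one (hγ : γ.IsLoop) (z : ℂ) : γ.subPt z 0 = γ.subPt z 1 := by
  rw [subPt_of_mem γ z ⟨le_rfl, zero_le_one⟩, subPt_of_mem γ z ⟨zero_le_one, le_rfl⟩]
  have := hγ
  rw [Curve.isLoop_iff, Curve.source_def, Curve.target_def] at this
  exact congrArg (· - z) this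

/-- For a loop and a point off its trace, `subPt` is a nonvanishing loop. [folklore] -/
theorem isNonvanishingLoop_subPt (hγ : γ.IsLoop) (hz : z ∉ γ.range) :
    Literature.Topology.PlaneTopology.IsNonvanishingLoop (γ.subPt z) := by
  refine ⟨(continuous_subPt γ z).continuousOn, fun t ht h ↦ ?_, subPt_zero_eq_one hγ z⟩
  rw [subPt_of_mem γ z ht, sub_eq_zero] at h
  exact hz ⟨_, h⟩

/-- **The winding number of a planar curve around a point**: `Literature.Topology.PlaneTopology.wind` of `t ↦ γ t − z`
(meaningful for a loop `γ` and `z` off its trace; `0` otherwise, `wind_of_mem_range`,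
`wind_of_not_isLoop`). [folklore] -/
def wind (γ : Curve ℂ) (z : ℂ) : ℤ := Literature.Topology.PlaneTopology.wind (γ.subPt z)

/-- Junk value on the trace (a vanishing function has no logarithm). [folklore] -/
theorem wind_of_mem_range (hz : z ∈ γ.range) : γ.wind z = 0 := by
  obtain ⟨t, rfl⟩ := hz
  rw [wind, Literature.Topology.PlaneTopology.wind, dif_neg]
  rintro ⟨hlog, -⟩
  have := hlog.ne_zero (x := (t : ℝ)) t.2
  rw [subPt_of_mem γ _ t.2] at this
  exact this (by simp)

/-- Junk value for non-loops. [folklore] -/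
theorem wind_of_not_isLoop (hγ : ¬ γ.IsLoop) : γ.wind z = 0 := by
  rw [wind, Literature.Topology.PlaneTopology.wind, dif_neg]
  rintro ⟨-, h01⟩
  apply hγ
  rw [subPt_of_mem γ z ⟨le_rfl, zero_le_one⟩, subPt_of_mem γ z ⟨zero_le_one, le_rfl⟩, sub_left_inj] at h01
  rw [Curve.isLoop_iff, Curve.source_def, Curve.target_def]
  exact h01

/-- A continuous logarithm of `γ − z` on `[0, 1]` computes the winding number. [folklore] -/
theorem wind_eq_of_log (hγ : γ.IsLoop) {l : ℝ → ℂ} (hl : ContinuousOn l (Icc 0 1))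
    (hle : ∀ (t : ℝ) (ht : t ∈ Icc (0 : ℝ) 1), exp (l t) = γ ⟨t, ht⟩ - z) {n : ℤ}
    (hn : l 1 - l 0 = n * (2 * π * Complex.I)) : γ.wind z = n := by
  have hspec := Literature.Topology.PlaneTopology.wind_spec (f := γ.subPt z) hl
    (fun t ht ↦ by rw [subPt_of_mem γ z ht]; exact hle t ht) (subPt_zero_eq_one hγ z)
  rw [hn] at hspec
  exact (Literature.Topology.PlaneTopology.int_eq_of_mul_two_pi_I_eq hspec).symm

/-- A loop off `z` has a continuous logarithm of `γ − z` on `[0, 1]`, and it computes `wind`. [folklore] -/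
theorem exists_log (hγ : γ.IsLoop) (hz : z ∉ γ.range) :
    ∃ l : ℝ → ℂ, ContinuousOn l (Icc 0 1) ∧
      (∀ (t : ℝ) (ht : t ∈ Icc (0 : ℝ) 1), exp (l t) = γ ⟨t, ht⟩ - z) ∧
      l 1 - l 0 = γ.wind z * (2 * π * Complex.I) := by
  obtain ⟨l, hl, hle⟩ := (isNonvanishingLoop_subPt hγ hz).hasLogOn
  refine ⟨l, hl, fun t ht ↦ by rw [hle t ht, subPt_of_mem γ z ht], ?_⟩
  exact Literature.Topology.PlaneTopology.wind_spec hl hle (subPt_zero_eq_one hγ z)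

/-- **Reparametrisation invariance.** [folklore] -/
theorem wind_reparam (γ : Curve ℂ) (φ : I ≃o I) (z : ℂ) : (γ.reparam φ).wind z = γ.wind z := by
  by_cases hz : z ∈ γ.range
  · rw [wind_of_mem_range hz, wind_of_mem_range (by rwa [Curve.range_reparam])]
  by_cases hγ : γ.IsLoop
  swap
  · rw [wind_of_not_isLoop hγ, wind_of_not_isLoop (fun h ↦ hγ ?_)]
    rwa [Curve.isLoop_iff, Curve.source_def, Curve.target_def, reparam_apply, reparam_apply,
      show φ 0 = 0 from φ.map_bot, show φ 1 = 1 from φ.map_top, ← Curve.source_def,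
      ← Curve.target_def, ← Curve.isLoop_iff] at h
  obtain ⟨l, hl, hle, hn⟩ := exists_log hγ hz
  -- `l ∘ φ` (read through `projIcc`) is a logarithm along the reparametrised curve
  set ψ : ℝ → ℝ := fun t ↦ (φ (projIcc 0 1 zero_le_one t) : ℝ) with hψ
  have hψmem : ∀ t, ψ t ∈ Icc (0 : ℝ) 1 := fun t ↦ (φ _).2
  have hψc : Continuous ψ := continuous_subtype_val.comp (φ.continuous.comp continuous_projIcc)
  refine wind_eq_of_log (isLoop_reparam hγ φ) (l := l ∘ ψ)
    (hl.comp hψc.continuousOn fun t _ ↦ hψmem t) (fun t ht ↦ ?_) ?_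
  · rw [Function.comp_apply, hle _ (hψmem t), reparam_apply]
    congr 2
    simp [hψ, projIcc_of_mem zero_le_one ht]
  · simp only [Function.comp_apply, hψ, projIcc_right, projIcc_left]
    have h1 : φ ⟨1, right_mem_Icc.2 zero_le_one⟩ = 1 := φ.map_top
    have h0 : φ ⟨0, left_mem_Icc.2 zero_le_one⟩ = 0 := φ.map_bot
    rw [h1, h0]
    exact hn

/-- **Time reversal negates the winding number.** [folklore] -/
theorem wind_reverse (γ : Curve ℂ) (z : ℂ) : γ.reverse.wind z = -γ.wind z := by
  by_cases hz : z ∈ γ.range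
  · rw [wind_of_mem_range hz, wind_of_mem_range (by rwa [Curve.range_reverse]), neg_zero]
  by_cases hγ : γ.IsLoop
  swap
  · rw [wind_of_not_isLoop hγ, wind_of_not_isLoop (fun h ↦ hγ ((isLoop_reverse_iff γ).1 h)), neg_zero]
  obtain ⟨l, hl, hle, hn⟩ := exists_log hγ hz
  set ψ : ℝ → ℝ := fun t ↦ 1 - (projIcc 0 1 zero_le_one t : ℝ) with hψ
  have hψmem : ∀ t, ψ t ∈ Icc (0 : ℝ) 1 := fun t ↦
    ⟨by have := (projIcc 0 1 zero_le_one t).2.2; simp only [hψ]; linarith,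
     by have := (projIcc 0 1 zero_le_one t).2.1; simp only [hψ]; linarith⟩
  have hψc : Continuous ψ := continuous_const.sub (continuous_subtype_val.comp continuous_projIcc)
  refine wind_eq_of_log ((isLoop_reverse_iff γ).2 hγ) (l := l ∘ ψ)
    (hl.comp hψc.continuousOn fun t _ ↦ hψmem t) (fun t ht ↦ ?_) ?_
  · rw [Function.comp_apply, hle _ (hψmem t), reverse_apply]
    congr 2
    apply Subtype.ext
    simp [hψ, projIcc_of_mem zero_le_one ht, unitInterval.coe_symm_eq]
  · simp only [Function.comp_apply, hψ, projIcc_right, projIcc_left, sub_self, sub_zero]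
    rw [show l 0 - l 1 = -(l 1 - l 0) by ring, hn]
    push_cast; ring

/-- **Change of base point does not change the winding number** (the shifts `γ.shift (s a)`,
`s ∈ [0, 1]`, form a free homotopy of loops with the same trace). [folklore] -/
theorem wind_shift (γ : Curve ℂ) (a : ℝ) (z : ℂ) : (γ.shift a).wind z = γ.wind z := by
  by_cases hγ : γ.IsLoop
  swap
  · rw [shift_of_not_isLoop hγ]
  by_cases hz : z ∈ γ.range
  · rw [wind_of_mem_range hz, wind_of_mem_range (by rwa [Curve.range_shift])]
  -- the homotopy `H s t = γ.loopMap (t + s a) - z`, read through `projIcc`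
  set H : ℝ → ℝ → ℂ := fun s t ↦ (γ.shift ((projIcc 0 1 zero_le_one s : ℝ) * a)).subPt z t with hH
  have hH0 : H 0 = γ.subPt z := by simp [hH]
  have hH1 : H 1 = (γ.shift a).subPt z := by simp [hH]
  rw [wind, wind, ← hH0, ← hH1]
  refine (wind_eq_of_homotopy H ?_ (fun s _ t ht ↦ ?_) (fun s _ ↦ ?_)).symm
  · -- joint continuity: `H s t = γ.loopMap (projIcc t + projIcc s * a) - z`
    have hform : (fun p : ℝ × ℝ ↦ H p.1 p.2) = fun p ↦
        γ.loopMap ((((projIcc 0 1 zero_le_one p.2 : ℝ) + (projIcc 0 1 zero_le_one p.1 : ℝ) * a : ℝ)) :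
          AddCircle (1 : ℝ)) - z := by
      funext p
      simp only [hH, subPt, IccExtend, Function.comp_apply]
      rw [shift_apply hγ]
    rw [hform]
    exact ((continuous_loopMap hγ).comp (by fun_prop)).continuousOn.sub continuousOn_const
  · exact (isNonvanishingLoop_subPt (isLoop_shift hγ _) (by rwa [Curve.range_shift])).ne_zero t ht
  · exact (isNonvanishingLoop_subPt (isLoop_shift hγ _) (by rwa [Curve.range_shift])).eq_endpoints

/-- **Stability**: loops uniformly closer than the distance from `z` to the trace of the first
have the same winding number around `z`. [folklore] -/
theorem wind_eq_of_dist_toContinuousMap_lt (hγ₁ : γ₁.IsLoop) (hγ₂ : γ₂.IsLoop)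
    (h : dist γ₁.toContinuousMap γ₂.toContinuousMap < Metric.infDist z γ₁.range) :
    γ₂.wind z = γ₁.wind z := by
  have hz₁ : z ∉ γ₁.range := by
    intro hz
    rw [Metric.infDist_zero_of_mem hz] at h
    exact (not_lt.2 dist_nonneg) h
  have hz₂ : z ∉ γ₂.range := by
    rintro ⟨t, ht⟩
    have h1 : dist (γ₁ t) (γ₂ t) ≤ dist γ₁.toContinuousMap γ₂.toContinuousMap :=
      ContinuousMap.dist_apply_le_dist t
    have h2 : Metric.infDist z γ₁.range ≤ dist z (γ₁ t) := Metric.infDist_le_dist_of_mem ⟨t, rfl⟩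
    rw [ht] at h1
    rw [dist_comm] at h2
    linarith
  refine Literature.Topology.PlaneTopology.wind_eq_of_norm_sub_lt (isNonvanishingLoop_subPt hγ₂ hz₂).continuousOn
    (isNonvanishingLoop_subPt hγ₂ hz₂).eq_endpoints (isNonvanishingLoop_subPt hγ₁ hz₁) fun t ht ↦ ?_
  rw [subPt_of_mem γ₂ z ht, subPt_of_mem γ₁ z ht]
  calc ‖γ₂ ⟨t, ht⟩ - z - (γ₁ ⟨t, ht⟩ - z)‖ = dist (γ₁ ⟨t, ht⟩) (γ₂ ⟨t, ht⟩) := by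
        rw [dist_comm, dist_eq_norm]; congr 1; ring
    _ ≤ dist γ₁.toContinuousMap γ₂.toContinuousMap := ContinuousMap.dist_apply_le_dist _
    _ < Metric.infDist z γ₁.range := h
    _ ≤ dist z (γ₁ ⟨t, ht⟩) := Metric.infDist_le_dist_of_mem ⟨_, rfl⟩
    _ = ‖γ₁ ⟨t, ht⟩ - z‖ := by rw [dist_comm, dist_eq_norm]

/-- Stability under the reparametrisation distance. [folklore] -/
theorem wind_eq_of_reparamDist_lt (hγ₁ : γ₁.IsLoop) (hγ₂ : γ₂.IsLoop)
    (h : reparamDist γ₁ γ₂ < Metric.infDist z γ₁.range) : γ₂.wind z = γ₁.wind z := by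
  obtain ⟨φ, hφ⟩ := exists_dist_reparam_lt (γ₁ := γ₁) (γ₂ := γ₂) (by rwa [Curve.dist_def])
  rw [← wind_reparam γ₂ φ]
  exact wind_eq_of_dist_toContinuousMap_lt hγ₁ (isLoop_reparam hγ₂ φ) hφ

/-- **Stability under the unbased oriented distance**: `loopDist γ₁ γ₂ < dist(z, trace γ₁)`
implies `W(γ₂, z) = W(γ₁, z)`. [folklore] -/
theorem wind_eq_of_loopDist_lt (hγ₁ : γ₁.IsLoop) (hγ₂ : γ₂.IsLoop)
    (h : loopDist γ₁ γ₂ < Metric.infDist z γ₁.range) : γ₂.wind z = γ₁.wind z := by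
  obtain ⟨b, hb⟩ := exists_lt_of_ciInf_lt h
  rw [← wind_shift γ₂ b]
  exact wind_eq_of_reparamDist_lt hγ₁ (isLoop_shift hγ₂ _) hb

/-- Curves at reparametrisation distance `0` have the same winding numbers. [folklore] -/
theorem wind_eq_of_reparamDist_eq_zero (h : reparamDist γ₁ γ₂ = 0) (z : ℂ) : γ₁.wind z = γ₂.wind z := by
  by_cases hγ₁ : γ₁.IsLoop
  · have hγ₂ : γ₂.IsLoop := (isLoop_iff_of_reparamDist_eq_zero h).1 hγ₁
    by_cases hz : z ∈ γ₁.range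
    · have hz' : z ∈ γ₂.range := by
        rwa [← CurveClass.range_mk, ← (CurveClass.mk_eq_mk_iff_dist_eq_zero.2 h : CurveClass.mk γ₁ = CurveClass.mk γ₂),
          CurveClass.range_mk]
      rw [wind_of_mem_range hz, wind_of_mem_range hz']
    · refine (wind_eq_of_reparamDist_lt hγ₁ hγ₂ ?_).symm
      rw [h]
      exact (γ₁.isCompact_range.isClosed.notMem_iff_infDist_pos γ₁.range_nonempty).1 hz
  · have hγ₂ : ¬ γ₂.IsLoop := fun h' ↦ hγ₁ ((isLoop_iff_of_reparamDist_eq_zero h).2 h')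
    rw [wind_of_not_isLoop hγ₁, wind_of_not_isLoop hγ₂]

/-- Loops at unbased distance `0` have the same winding numbers. [folklore] -/
theorem wind_eq_of_loopDist_eq_zero (hγ₁ : γ₁.IsLoop) (hγ₂ : γ₂.IsLoop) (h : loopDist γ₁ γ₂ = 0)
    (z : ℂ) : γ₁.wind z = γ₂.wind z := by
  by_cases hz : z ∈ γ₁.range
  · have hz' : z ∈ γ₂.range := by
      have h0 : Metric.infDist z γ₂.range = 0 :=
        le_antisymm (h ▸ hz.elim fun t ht ↦ ht ▸ infDist_range_le_loopDist γ₁ γ₂ t) Metric.infDist_nonneg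
      have := (Metric.mem_closure_iff_infDist_zero γ₂.range_nonempty).2 h0
      rwa [γ₂.isCompact_range.isClosed.closure_eq] at this
    rw [wind_of_mem_range hz, wind_of_mem_range hz']
  · refine (wind_eq_of_loopDist_lt hγ₁ hγ₂ ?_).symm
    rw [h]
    exact (γ₁.isCompact_range.isClosed.notMem_iff_infDist_pos γ₁.range_nonempty).1 hz

/-- **A loop inside a ball not containing `z` has `W = 0`** (compare with the constant loop at
the centre, `wind_eq_of_norm_sub_lt` + `wind_const`). [folklore] -/
theorem wind_eq_zero_of_subset_ball {w : ℂ} {ρ : ℝ} (hγw : γ.range ⊆ Metric.ball w ρ)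
    (hz : ρ ≤ dist z w) : γ.wind z = 0 := by
  by_cases hγ : γ.IsLoop
  swap
  · exact wind_of_not_isLoop hγ
  have hwz : w - z ≠ 0 := by
    intro h
    rw [sub_eq_zero] at h
    subst h
    have := hγw ⟨0, rfl⟩
    rw [Metric.mem_ball] at this
    rw [dist_self] at hz
    linarith [dist_nonneg (x := γ 0) (y := w)]
  have hz' : z ∉ γ.range := fun h ↦ by
    have := hγw h; rw [Metric.mem_ball] at this; linarith
  rw [wind, ← Literature.Topology.PlaneTopology.wind_const (w - z)]
  refine Literature.Topology.PlaneTopology.wind_eq_of_norm_sub_lt (isNonvanishingLoop_subPt hγ hz').continuousOn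
    (isNonvanishingLoop_subPt hγ hz').eq_endpoints (Literature.Topology.PlaneTopology.IsNonvanishingLoop.const hwz) fun t ht ↦ ?_
  rw [subPt_of_mem γ z ht]
  have := hγw ⟨⟨t, ht⟩, rfl⟩
  rw [Metric.mem_ball, dist_eq_norm] at this
  calc ‖γ ⟨t, ht⟩ - z - (w - z)‖ = ‖γ ⟨t, ht⟩ - w‖ := by congr 1; ring
    _ < ρ := this
    _ ≤ dist z w := hz
    _ = ‖w - z‖ := by rw [dist_comm, dist_eq_norm]

/-! ### Invariance under orientation-preserving similarities -/

/-- **Orientation-preserving similarities preserve winding numbers**: for `a ≠ 0`,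
`W(aγ + b, az + b) = W(γ, z)` (`aγ + b − (az + b) = a (γ − z)` and the constant loop `a` has
winding number `0`, `wind_mul`). [folklore] -/
theorem wind_map_affine (γ : Curve ℂ) {a : ℂ} (ha : a ≠ 0) (b z : ℂ) :
    (γ.map ⟨fun w ↦ a * w + b, by fun_prop⟩).wind (a * z + b) = γ.wind z := by
  set f : C(ℂ, ℂ) := ⟨fun w ↦ a * w + b, by fun_prop⟩ with hf
  have hfinj : Function.Injective f := fun x y h ↦ by simpa [hf, ha] using h
  by_cases hz : z ∈ γ.range
  · rw [wind_of_mem_range hz, wind_of_mem_range]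
    rw [Curve.range_map]; exact ⟨z, hz, rfl⟩
  by_cases hγ : γ.IsLoop
  swap
  · rw [wind_of_not_isLoop hγ, wind_of_not_isLoop]
    intro h
    apply hγ
    rw [Curve.isLoop_iff, Curve.source_def, Curve.target_def] at h ⊢
    exact hfinj h
  have hmul : (γ.map f).subPt (a * z + b) = fun t ↦ (fun _ : ℝ ↦ a) t * γ.subPt z t := by
    funext t
    simp only [subPt, IccExtend, Function.comp_apply, Curve.map_apply, hf, ContinuousMap.coe_mk]
    ring
  rw [wind, hmul, Literature.Topology.PlaneTopology.wind_mul (Literature.Topology.PlaneTopology.IsNonvanishingLoop.const ha) (isNonvanishingLoop_subPt hγ hz), Literature.Topology.PlaneTopology.wind_const,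
    zero_add, wind]

end Curve

/-! ### Winding numbers of curve classes, based and unbased loops -/

namespace CurveClass

/-- The winding number of a curve class around a point (junk `0` for non-loops and for points on
the trace). [folklore] -/
def wind : CurveClass ℂ → ℂ → ℤ :=
  SeparationQuotient.lift Curve.wind fun _ _ h ↦ funext fun z ↦
    Curve.wind_eq_of_reparamDist_eq_zero (Metric.inseparable_iff.1 h) z

/-- `wind` on the class of a curve. [folklore] -/
@[simp] theorem wind_mk (γ : Curve ℂ) (z : ℂ) : wind (mk γ) z = γ.wind z := rfl

/-- Time reversal negates the winding number of a class. [folklore] -/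
theorem wind_reverse (c : CurveClass ℂ) (z : ℂ) : c.reverse.wind z = -c.wind z := by
  obtain ⟨γ, rfl⟩ := surjective_mk c
  simp [Curve.wind_reverse]

/-- Orientation-preserving similarities preserve winding numbers of classes. [folklore] -/
theorem wind_map_affine (c : CurveClass ℂ) {a : ℂ} (ha : a ≠ 0) (b z : ℂ) :
    (c.map ⟨fun w ↦ a * w + b, by fun_prop⟩).wind (a * z + b) = c.wind z := by
  obtain ⟨γ, rfl⟩ := surjective_mk c
  rw [map_mk, wind_mk, wind_mk, Curve.wind_map_affine γ ha b z]

end CurveClass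

namespace UnbasedLoop

/-- **The winding number of an unbased oriented loop** around a point off its trace (well
defined: `Curve.wind_eq_of_loopDist_eq_zero`); junk `0` on the trace. [folklore] -/
def wind : UnbasedLoop ℂ → ℂ → ℤ :=
  SeparationQuotient.lift (fun ℓ : BasedLoop ℂ ↦ CurveClass.wind ℓ.toCurveClass) fun a b h ↦ by
    funext z
    obtain ⟨c, hc⟩ := a
    obtain ⟨c', hc'⟩ := b
    obtain ⟨α, rfl⟩ := CurveClass.surjective_mk c
    obtain ⟨β, rfl⟩ := CurveClass.surjective_mk c'
    exact Curve.wind_eq_of_loopDist_eq_zero hc hc' (Metric.inseparable_iff.1 h) z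

/-- `wind` on the unbased loop of a based loop. [folklore] -/
@[simp] theorem wind_mk (ℓ : BasedLoop ℂ) (z : ℂ) : wind (mk ℓ) z = CurveClass.wind ℓ.toCurveClass z := rfl

/-- **Time reversal negates the winding number.** [folklore] -/
theorem wind_reverse (u : UnbasedLoop ℂ) (z : ℂ) : u.reverse.wind z = -u.wind z := by
  obtain ⟨ℓ, rfl⟩ := mk_surjective u
  rw [reverse_mk, wind_mk, wind_mk, BasedLoop.toCurveClass_reverse, CurveClass.wind_reverse]

/-- **Stability under the oriented unbased distance**: `dist u v < dist (z, trace u)` implies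
`W(v, z) = W(u, z)`. [folklore] -/
theorem wind_eq_of_dist_lt {u v : UnbasedLoop ℂ} {z : ℂ} (h : dist u v < Metric.infDist z u.range) :
    v.wind z = u.wind z := by
  obtain ⟨⟨c, hc⟩, rfl⟩ := mk_surjective u
  obtain ⟨⟨c', hc'⟩, rfl⟩ := mk_surjective v
  obtain ⟨α, rfl⟩ := CurveClass.surjective_mk c
  obtain ⟨β, rfl⟩ := CurveClass.surjective_mk c'
  exact Curve.wind_eq_of_loopDist_lt hc hc' h

/-- **Up to sign under the unoriented distance**: `udist u v < dist (z, trace u)` implies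
`W(v, z) = W(u, z)` or `W(v, z) = −W(u, z)` (according as the optimal matching preserves or
reverses orientation). [folklore] -/
theorem wind_eq_or_eq_neg_of_udist_lt {u v : UnbasedLoop ℂ} {z : ℂ}
    (h : udist u v < Metric.infDist z u.range) : v.wind z = u.wind z ∨ v.wind z = -u.wind z := by
  rcases min_cases (dist u v) (dist u v.reverse) with ⟨hmin, -⟩ | ⟨hmin, -⟩ <;> rw [udist, hmin] at h
  · exact Or.inl (wind_eq_of_dist_lt h)
  · right
    have := wind_eq_of_dist_lt h
    rw [wind_reverse] at this
    linarith

/-- **The orientation lemma.** Let `u` be *fat at scale `ε`*: it winds (`W ≠ 0`) around some point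
`z` at distance `> ε` from its trace; and let `u`, `v` both have winding numbers of a fixed sign
`s` (`s = 1` or `s = -1`) around every point. If `d(u, v) ≤ ε` for DKKMO's unoriented distance `d`,
then already the *oriented* unbased distance is `≤ ε`: an orientation-reversing `ε`-matching would
give `W(v, z) = −W(u, z)` of the wrong sign. [folklore] -/
theorem dist_le_of_udist_le {u v : UnbasedLoop ℂ} {ε : ℝ} {s : ℤ}
    (hfat : ∃ z, ε < Metric.infDist z u.range ∧ u.wind z ≠ 0)
    (hu : ∀ z, 0 ≤ s * u.wind z) (hv : ∀ z, 0 ≤ s * v.wind z) (hs : s = 1 ∨ s = -1)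
    (hd : udist u v ≤ ε) : dist u v ≤ ε := by
  rcases min_cases (dist u v) (dist u v.reverse) with ⟨hmin, -⟩ | ⟨hmin, hlt⟩
  · rwa [udist, hmin] at hd
  · exfalso
    obtain ⟨z, hz, hne⟩ := hfat
    rw [udist, hmin] at hd
    have h := wind_eq_of_dist_lt (hd.trans_lt hz)
    rw [wind_reverse] at h
    have h1 := hu z
    have h2 := hv z
    rcases hs with rfl | rfl
    · simp only [one_mul] at h1 h2; omega
    · simp only [neg_mul, one_mul, Left.nonneg_neg_iff] at h1 h2; omega

end UnbasedLoop

end Literature.Probability.RandomPlanarGeometry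

end
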